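import Literature.Geometry.Riemannian.BoundaryAdaptedHessian
import Literature.Geometry.Riemannian.BoundaryAdaptedProfile
import Literature.Geometry.Riemannian.BoundaryAdaptedGenericity
import Literature.Topology.FourManifolds.RegularLevelSplitting
import Literature.Topology.FourManifolds.Handles
import Literature.Topology.FourManifolds.MorseBirthLemma
import Mathlib.Geometry.Manifold.PartitionOfUnity
import Mathlib.Topology.MetricSpace.Thickening
import Mathlib.Analysis.Calculus.FDeriv.Mul
import Mathlib.Analysis.Calculus.Deriv.Comp
import HarnessLib

/-!
# A compact domain with `p`-convex boundary is a `(p-1)`-handlebody: the boundary-adapted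
# height function (flat case of Sha 1986, Thm. 1 — the Morse-theoretic half)
(topic `Literature/Geometry/Riemannian`; fourth file of the discharge of the named fact
`Literature.Geometry.Riemannian.Sha1986_homotopyEquiv_cwComplex_of_pConvex` of
`PConvexDomainHomotopyType.lean`, after `BoundaryAdaptedHessian.lean` (linear algebra of the
Hessians `κ D²F + N DF ⊗ DF`), `BoundaryAdaptedProfile.lean` (the profile `λ`) and
`BoundaryAdaptedGenericity.lean` (generic directions, margins))

**Theorem** (`exists_isRegularLevel_isHandlebodyOfIndexLE`).  *Let `F : ℝⁿ⁺¹ → ℝ` be smooth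
with `Ω = {F ≤ 0}` compact, `DF ≠ 0` on `{F = 0}`, and `∑ᵢ D²F(x)(vᵢ, vᵢ) > 0` for every
`x ∈ {F = 0}` and every orthonormal `p`-frame `(vᵢ)` in `ker DF(x)`, `p ≥ 1` (`∂Ω` is
`p`-convex for the inner normal).  Then `Ω`, as the compact smooth manifold with boundary
`Literature.Topology.FourManifolds.RegularSublevel` of a smooth function `G` with regular top
level `{G = 1} = ∂Ω` and `{G ≤ 1} = Ω`, carries a Morse function adapted to `∂Ω` all of whose
critical points have index `≤ p - 1`: `IsHandlebodyOfIndexLE n (p - 1)`.*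

This is the Morse-theoretic half of Sha's theorem in the flat case (Sha, Invent. Math. 83
(1986), Thm. 1; Wu, Indiana Univ. Math. J. 36 (1987), Thm. 1; Xiong, Int. J. Math. 29 (2018),
Thm. 4 (i), §4: "construct a suitable `q`-convex function, then smooth it and apply the standard
Morse theory"): the printed road builds the `p`-convex Morse function from the distance to the
boundary and the Greene–Wu smoothing theorem; here it is the boundary-adapted generic height
function `G = 1 + λ(-F) · (⟪a, ·⟫ - c₁)` of Morse theory on manifolds with boundary (only the
boundary critical points of `⟪a, ·⟫|∂Ω` with `a` pointing inward contribute, with their Morse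
index, which `p`-convexity bounds by `p - 1`; the mechanism named by the route `ConvexityLadder`,
item `CvxThreeConvexBoundsTwoHandlebody`).  The homotopy-type conclusion of the named fact (a
finite CW complex of dimension `≤ p - 1`) then follows by Milnor's Thm. 3.5 for adapted Morse
functions, which is the remaining (topological) half.

## Contents (all proved; no definitions, no named facts)

* §1 constants of `F` near `∂Ω` by compactness: `exists_collar_le_norm_fderiv` (`‖DF‖ ≥ m` on a
  collar), `exists_bound_fderiv_fderiv` (`|D²F| ≤ M` on `Ω`), `exists_collar_sum_pos`
  (`p`-convexity with margin `η` on a collar), and the cut-off height `exists_neg_cutoff`;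
* §2 calculus of `G = 1 + λ(-F) k`: `hasFDerivAt_boundaryAdapted`, `fderiv_boundaryAdapted`,
  `fderiv_fderiv_boundaryAdapted`;
* §3 `sublevel'_morseData_of_nondegenerate`, `RegularSublevel.morseData_of_nondegenerate` —
  Milnor's Thm. 3.1 with the Morse data (the tree's `sublevel'_morseData`,
  `RegularSublevel.morseData`) for a function which is Morse only on the sublevel set;
* §4 `boundaryAdapted_le_one_iff`, `boundaryAdapted_eq_one_iff` and the theorem
  `exists_isRegularLevel_isHandlebodyOfIndexLE`.

## References

* J.-P. Sha, *`p`-convex Riemannian manifolds*, Invent. Math. 83 (1986), 437–447, Thm. 1.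
  [Sha1986]
* H. Wu, *Manifolds of partially positive curvature*, Indiana Univ. Math. J. 36 (1987), Thm. 1.
  [Wu1987]
* C. Xiong, *Homotopy type of manifolds with partially horoconvex boundary*, Int. J. Math. 29
  (2018), Thm. 4 (i), §4. [Xiong2018]
* J. Milnor, *Morse theory*, Ann. of Math. Studies 51 (1963), §§2–3 (Thm. 3.1), §6.
  [Milnor1963]
-/

noncomputable section

open scoped ContDiff Topology Manifold InnerProductSpace
open Set Filter Function Module Metric

namespace Literature.Geometry.Riemannian

open Literature.Topology.FourManifolds

universe u

/-! ### §1 Constants of `F` near the boundary; the cut-off height -/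

section Collar

variable {E : Type*} [NormedAddCommGroup E] [InnerProductSpace ℝ E] [FiniteDimensional ℝ E]

omit [FiniteDimensional ℝ E] in
/-- **The gradient on a collar.**  If `Ω = {F ≤ 0}` is compact and `DF ≠ 0` on `{F = 0}`, then
`DF ≠ 0`, indeed `‖DF‖ ≥ m > 0`, on a collar `{-δ ≤ F ≤ 0}`: the critical points of `F` in `Ω`
form a compact set on which `F < 0`. [folklore] -/
theorem exists_collar_le_norm_fderiv {F : E → ℝ} (hF : ContDiff ℝ ∞ F)
    (hK : IsCompact {x | F x ≤ 0}) (hreg : ∀ x, F x = 0 → fderiv ℝ F x ≠ 0) :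
    ∃ δ > 0, ∃ m > 0, ∀ x, -δ ≤ F x → F x ≤ 0 → m ≤ ‖fderiv ℝ F x‖ := by
  have hFc : Continuous F := hF.continuous
  have hDc : Continuous (fderiv ℝ F) := hF.continuous_fderiv (by simp)
  -- the critical points of `F` in `{F ≤ 0}` have `F ≤ -2δ`
  set C : Set E := {x | F x ≤ 0} ∩ {x | fderiv ℝ F x = 0} with hC
  have hCc : IsCompact C := hK.inter_right (isClosed_eq hDc continuous_const)
  obtain ⟨δ, hδ, hδC⟩ : ∃ δ > 0, ∀ x ∈ C, δ ≤ -F x := by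
    refine hCc.exists_forall_le' (continuous_neg.comp_continuousOn hFc.continuousOn)
      fun x hx => ?_
    have h1 : F x ≠ 0 := fun h0 => hreg x h0 hx.2
    have h2 : F x ≤ 0 := hx.1
    show 0 < -F x
    exact neg_pos.2 (lt_of_le_of_ne h2 h1)
  -- on the collar `{-δ/2 ≤ F ≤ 0}` the gradient does not vanish and is bounded below
  set B : Set E := {x | F x ≤ 0} ∩ {x | -(δ / 2) ≤ F x} with hB
  have hBc : IsCompact B := hK.inter_right (isClosed_le continuous_const hFc)
  obtain ⟨m, hm, hmB⟩ : ∃ m > 0, ∀ x ∈ B, m ≤ ‖fderiv ℝ F x‖ := by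
    refine hBc.exists_forall_le' (continuous_norm.comp_continuousOn hDc.continuousOn)
      fun x hx => norm_pos_iff.2 fun h0 => ?_
    have h3 := hδC x ⟨hx.1, h0⟩
    have h4 : -(δ / 2) ≤ F x := hx.2
    linarith
  exact ⟨δ / 2, by positivity, m, hm, fun x h1 h2 => hmB x ⟨h2, h1⟩⟩

omit [FiniteDimensional ℝ E] in
/-- **A bound for the Hessian on `Ω`**: `|D²F(x)(u, w)| ≤ M ‖u‖ ‖w‖` for `x ∈ {F ≤ 0}` compact.
[folklore] -/
theorem exists_bound_fderiv_fderiv {F : E → ℝ} (hF : ContDiff ℝ ∞ F)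
    (hK : IsCompact {x | F x ≤ 0}) :
    ∃ M ≥ 0, ∀ x, F x ≤ 0 → ∀ u w, |fderiv ℝ (fderiv ℝ F) x u w| ≤ M * ‖u‖ * ‖w‖ := by
  have hF1 : ContDiff ℝ ∞ (fderiv ℝ F) := hF.fderiv_right le_rfl
  have hD2c : Continuous (fderiv ℝ (fderiv ℝ F)) := hF1.continuous_fderiv (by simp)
  obtain ⟨M, hM⟩ := hK.exists_bound_of_continuousOn (f := fderiv ℝ (fderiv ℝ F)) hD2c.continuousOn
  refine ⟨max M 0, le_max_right _ _, fun x hx u w => ?_⟩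
  have h1 : ‖fderiv ℝ (fderiv ℝ F) x‖ ≤ max M 0 := (hM x hx).trans (le_max_left _ _)
  calc |fderiv ℝ (fderiv ℝ F) x u w| = ‖fderiv ℝ (fderiv ℝ F) x u w‖ := (Real.norm_eq_abs _).symm
    _ ≤ ‖fderiv ℝ (fderiv ℝ F) x u‖ * ‖w‖ := ContinuousLinearMap.le_opNorm _ _
    _ ≤ ‖fderiv ℝ (fderiv ℝ F) x‖ * ‖u‖ * ‖w‖ := by
        gcongr; exact ContinuousLinearMap.le_opNorm _ _
    _ ≤ max M 0 * ‖u‖ * ‖w‖ := by gcongr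

/-- **`p`-convexity spreads to a collar with a margin.**  If `∑ᵢ D²F(x)(vᵢ, vᵢ) > 0` for every
`x ∈ ∂Ω = {F = 0}` and every orthonormal `p`-frame `(vᵢ)` in `ker DF(x)` (`Ω = {F ≤ 0}` compact),
then for some `δ, η > 0` the sum is `≥ η` for every `x` in the collar `{-δ ≤ F ≤ 0}` and every
orthonormal `p`-frame in `ker DF(x)` — the parallel hypersurfaces `{F = -s}`, `s < δ`, are
uniformly `p`-convex.  Proof: the tangential orthonormal `p`-frames over `Ω` form a compact
subset of `E × Eᵖ`; on those over `∂Ω` the (continuous) sum has a positive minimum `η₀`, and the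
frames with sum `≤ η₀/2` form a compact set over which `F < 0`, hence `F ≤ -2δ`. [folklore] -/
theorem exists_collar_sum_pos {F : E → ℝ} (hF : ContDiff ℝ ∞ F)
    (hK : IsCompact {x | F x ≤ 0}) {p : ℕ}
    (hconv : ∀ x, F x = 0 → ∀ v : Fin p → E, Orthonormal ℝ v →
      (∀ i, fderiv ℝ F x (v i) = 0) → 0 < ∑ i, fderiv ℝ (fderiv ℝ F) x (v i) (v i)) :
    ∃ δ > 0, ∃ η > 0, ∀ x, -δ ≤ F x → F x ≤ 0 → ∀ v : Fin p → E, Orthonormal ℝ v →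
      (∀ i, fderiv ℝ F x (v i) = 0) → η ≤ ∑ i, fderiv ℝ (fderiv ℝ F) x (v i) (v i) := by
  have hFc : Continuous F := hF.continuous
  have hDc : Continuous (fderiv ℝ F) := hF.continuous_fderiv (by simp)
  have hF1 : ContDiff ℝ ∞ (fderiv ℝ F) := hF.fderiv_right le_rfl
  have hD2c : Continuous (fderiv ℝ (fderiv ℝ F)) := hF1.continuous_fderiv (by simp)
  -- the compact set of tangential orthonormal `p`-frames over `{F ≤ 0}`
  set S : Set (E × (Fin p → E)) := {q | F q.1 ≤ 0 ∧ Orthonormal ℝ q.2 ∧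
    ∀ i, fderiv ℝ F q.1 (q.2 i) = 0} with hS
  have hSclosed : IsClosed S := by
    have h1 : IsClosed {q : E × (Fin p → E) | F q.1 ≤ 0} :=
      isClosed_le (hFc.comp continuous_fst) continuous_const
    have h2 : IsClosed {q : E × (Fin p → E) | Orthonormal ℝ q.2} := by
      have : {q : E × (Fin p → E) | Orthonormal ℝ q.2} =
          ⋂ i, ⋂ j, {q | ⟪q.2 i, q.2 j⟫_ℝ = if i = j then (1 : ℝ) else 0} := by
        ext q
        simp only [mem_setOf_eq, orthonormal_iff_ite, mem_iInter]
      rw [this]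
      refine isClosed_iInter fun i => isClosed_iInter fun j => isClosed_eq ?_ continuous_const
      exact ((continuous_apply i).comp continuous_snd).inner
        ((continuous_apply j).comp continuous_snd)
    have h3 : IsClosed {q : E × (Fin p → E) | ∀ i, fderiv ℝ F q.1 (q.2 i) = 0} := by
      have : {q : E × (Fin p → E) | ∀ i, fderiv ℝ F q.1 (q.2 i) = 0} =
          ⋂ i, {q | fderiv ℝ F q.1 (q.2 i) = 0} := by ext q; simp
      rw [this]
      refine isClosed_iInter fun i => isClosed_eq ?_ continuous_const
      exact (hDc.comp continuous_fst).clm_apply ((continuous_apply i).comp continuous_snd)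
    have : S = {q : E × (Fin p → E) | F q.1 ≤ 0} ∩ ({q | Orthonormal ℝ q.2} ∩
        {q | ∀ i, fderiv ℝ F q.1 (q.2 i) = 0}) := by
      ext q; simp [hS]
    rw [this]
    exact h1.inter (h2.inter h3)
  have hSsub : S ⊆ {x : E | F x ≤ 0} ×ˢ (Set.pi univ fun _ : Fin p => closedBall (0 : E) 1) := by
    rintro ⟨x, v⟩ ⟨hx, hv, -⟩
    refine ⟨hx, fun i _ => ?_⟩
    rw [mem_closedBall, dist_zero_right, hv.1 i]
  have hSc : IsCompact S :=
    (hK.prod (isCompact_univ_pi fun _ => isCompact_closedBall (0 : E) 1)).of_isClosed_subset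
      hSclosed hSsub
  -- the continuous function `∑ D²F(x)(vᵢ, vᵢ)`
  set φ : E × (Fin p → E) → ℝ := fun q => ∑ i, fderiv ℝ (fderiv ℝ F) q.1 (q.2 i) (q.2 i) with hφ
  have hφc : Continuous φ := by
    refine continuous_finsetSum _ fun i _ => ?_
    exact ((hD2c.comp continuous_fst).clm_apply ((continuous_apply i).comp continuous_snd)).clm_apply
      ((continuous_apply i).comp continuous_snd)
  -- positive on the boundary frames, hence `≥ η₀` there
  set S₀ : Set (E × (Fin p → E)) := S ∩ {q | F q.1 = 0} with hS₀
  have hS₀c : IsCompact S₀ := hSc.inter_right (isClosed_eq (hFc.comp continuous_fst) continuous_const)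
  obtain ⟨η₀, hη₀, hη₀S⟩ : ∃ η₀ > 0, ∀ q ∈ S₀, η₀ ≤ φ q :=
    hS₀c.exists_forall_le' hφc.continuousOn fun q hq =>
      hconv q.1 hq.2 q.2 hq.1.2.1 hq.1.2.2
  -- frames with small sum stay away from the boundary
  set Q : Set (E × (Fin p → E)) := S ∩ {q | φ q ≤ η₀ / 2} with hQ
  have hQc : IsCompact Q := hSc.inter_right (isClosed_le hφc continuous_const)
  obtain ⟨δ, hδ, hδQ⟩ : ∃ δ > 0, ∀ q ∈ Q, δ ≤ -F q.1 := by
    refine hQc.exists_forall_le'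
      ((continuous_neg.comp (hFc.comp continuous_fst)).continuousOn) fun q hq => ?_
    have h1 : F q.1 ≠ 0 := fun h0 => by
      have := hη₀S q ⟨hq.1, h0⟩
      have := hq.2
      simp only [mem_setOf_eq] at this
      linarith
    show 0 < -F q.1
    exact neg_pos.2 (lt_of_le_of_ne hq.1.1 h1)
  refine ⟨δ / 2, by positivity, η₀ / 2, by positivity, fun x h1 h2 v hv htan => ?_⟩
  by_contra hlt
  push Not at hlt
  have hqQ : (x, v) ∈ Q := ⟨⟨h2, hv, htan⟩, hlt.le⟩
  have := hδQ _ hqQ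
  simp only at this
  linarith

/-- **The cut-off height `k`.**  For `Ω = {F ≤ 0}` compact and a direction `a` there are a smooth
`k : E → ℝ`, negative everywhere, a constant `c₁` and an open neighbourhood `N` of `Ω` with
`k = ⟪a, ·⟫ - c₁` on `N` (`c₁ > sup_Ω ⟪a, ·⟫`; a smooth bump `φ` equal to `1` on a closed
thickening of `Ω` inside `{⟪a, ·⟫ < c₁}` and to `0` outside it, Mathlib's
`exists_contMDiffMap_zero_one_of_isClosed`, and `k = φ (⟪a, ·⟫ - c₁) - (1 - φ)`).  With `k < 0`
everywhere the boundary-adapted function `G = 1 + λ(-F) k` satisfies `{G ≤ 1} = {F ≤ 0}` on the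
whole space (`boundaryAdapted_le_one_iff`). [folklore] -/
theorem exists_neg_cutoff {F : E → ℝ} (hK : IsCompact {x | F x ≤ 0}) (a : E) :
    ∃ (k : E → ℝ) (c₁ : ℝ) (N : Set E), ContDiff ℝ ∞ k ∧ (∀ x, k x < 0) ∧ IsOpen N ∧
      {x | F x ≤ 0} ⊆ N ∧ ∀ x ∈ N, k x = ⟪a, x⟫_ℝ - c₁ := by
  obtain ⟨C, hC⟩ := hK.exists_bound_of_continuousOn (f := fun x => ⟪a, x⟫_ℝ)
    ((innerSL ℝ a).continuous.continuousOn)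
  set c₁ : ℝ := C + 1 with hc₁
  set W : Set E := {x | ⟪a, x⟫_ℝ < c₁} with hW
  have hWopen : IsOpen W := isOpen_lt (innerSL ℝ a).continuous continuous_const
  have hKW : {x | F x ≤ 0} ⊆ W := fun x hx => by
    have := hC x hx
    rw [Real.norm_eq_abs] at this
    show ⟪a, x⟫_ℝ < C + 1
    linarith [le_abs_self ⟪a, x⟫_ℝ]
  obtain ⟨r, hr, hrW⟩ := hK.exists_cthickening_subset_open hWopen hKW
  obtain ⟨φ, hφ0, hφ1, hφ01⟩ := exists_contMDiffMap_zero_one_of_isClosed (𝓘(ℝ, E)) (n := ⊤)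
    hWopen.isClosed_compl (isClosed_cthickening (δ := r) (E := {x | F x ≤ 0}))
    (disjoint_compl_left_iff_subset.2 hrW)
  have hφs : ContDiff ℝ ∞ φ := contMDiff_iff_contDiff.1 φ.contMDiff
  refine ⟨fun x => φ x * (⟪a, x⟫_ℝ - c₁) - (1 - φ x), c₁, thickening r {x | F x ≤ 0},
    (hφs.mul ((innerSL ℝ a).contDiff.sub contDiff_const)).sub (contDiff_const.sub hφs),
    fun x => ?_, isOpen_thickening, self_subset_thickening hr _, fun x hx => ?_⟩
  · have h01 := hφ01 x
    show φ x * (⟪a, x⟫_ℝ - c₁) - (1 - φ x) < 0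
    by_cases hx : x ∈ W
    · have : ⟪a, x⟫_ℝ - c₁ < 0 := sub_neg.2 hx
      rcases h01.1.eq_or_lt with h0 | hpos
      · rw [← h0]; norm_num
      · nlinarith [h01.2]
    · have h0 : φ x = 0 := hφ0 hx
      rw [h0]; norm_num
  · have h1 : φ x = 1 := hφ1 (thickening_subset_cthickening r _ hx)
    simp [h1]

end Collar

/-! ### §2 Calculus of the boundary-adapted function -/

section Calculus

variable {E : Type*} [NormedAddCommGroup E] [InnerProductSpace ℝ E]

/-- **First derivative of the boundary-adapted function** `G = 1 + λ(-F) · k`: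
`DG = λ(-F) Dk - (k λ'(-F)) DF` (chain and product rules). [folklore] -/
theorem hasFDerivAt_boundaryAdapted {lam : ℝ → ℝ} (hlam : ContDiff ℝ ∞ lam) {F k : E → ℝ}
    (hF : ContDiff ℝ ∞ F) (hk : ContDiff ℝ ∞ k) (x : E) :
    HasFDerivAt (fun x => 1 + lam (-F x) * k x)
      (lam (-F x) • fderiv ℝ k x - (k x * deriv lam (-F x)) • fderiv ℝ F x) x := by
  have hFd : HasFDerivAt F (fderiv ℝ F x) x := (hF.differentiable (by simp) x).hasFDerivAt
  have hkd : HasFDerivAt k (fderiv ℝ k x) x := (hk.differentiable (by simp) x).hasFDerivAt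
  have hlamd : HasDerivAt lam (deriv lam (-F x)) (-F x) :=
    (hlam.differentiable (by simp) _).hasDerivAt
  have h1 : HasFDerivAt (fun x => lam (-F x)) (deriv lam (-F x) • (-fderiv ℝ F x)) x :=
    hlamd.comp_hasFDerivAt x hFd.neg
  have h2 := (h1.mul hkd).const_add 1
  refine h2.congr_fderiv ?_
  ext u
  simp only [FunLike.coe_sub, FunLike.coe_add,
    FunLike.coe_smul, FunLike.coe_neg, Pi.sub_apply, Pi.add_apply,
    Pi.smul_apply, Pi.neg_apply, smul_eq_mul]
  ring

/-- `fderiv` form of `hasFDerivAt_boundaryAdapted`. [folklore] -/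
theorem fderiv_boundaryAdapted {lam : ℝ → ℝ} (hlam : ContDiff ℝ ∞ lam) {F k : E → ℝ}
    (hF : ContDiff ℝ ∞ F) (hk : ContDiff ℝ ∞ k) (x : E) :
    fderiv ℝ (fun x => 1 + lam (-F x) * k x) x =
      lam (-F x) • fderiv ℝ k x - (k x * deriv lam (-F x)) • fderiv ℝ F x :=
  (hasFDerivAt_boundaryAdapted hlam hF hk x).fderiv

/-- **Second derivative of the boundary-adapted function** where `Dk = L` is locally constant
(`k` affine near the point):
`D²G(x₀)(u, w) = -λ' (DF u · L w + L u · DF w) - k λ' D²F(u, w) + k λ'' DF u · DF w`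
(all profile derivatives at `-F x₀`).  At a critical point `L = (k λ'/λ) DF`, and this becomes
`(-k) [λ' D²F + (2λ'²/λ - λ'') DF ⊗ DF]`, the form treated in `BoundaryAdaptedHessian.lean`.
[folklore] -/
theorem fderiv_fderiv_boundaryAdapted {lam : ℝ → ℝ} (hlam : ContDiff ℝ ∞ lam) {F k : E → ℝ}
    (hF : ContDiff ℝ ∞ F) (hk : ContDiff ℝ ∞ k) {L : E →L[ℝ] ℝ} {x₀ : E}
    (hL : ∀ᶠ x in 𝓝 x₀, fderiv ℝ k x = L) (u w : E) :
    fderiv ℝ (fderiv ℝ (fun x => 1 + lam (-F x) * k x)) x₀ u w =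
      -(deriv lam (-F x₀) * (fderiv ℝ F x₀ u * L w + L u * fderiv ℝ F x₀ w))
      - k x₀ * deriv lam (-F x₀) * fderiv ℝ (fderiv ℝ F) x₀ u w
      + k x₀ * deriv (deriv lam) (-F x₀) * (fderiv ℝ F x₀ u * fderiv ℝ F x₀ w) := by
  -- near `x₀`, `DG = λ(-F) • L - (k λ'(-F)) • DF`
  set Φ : E → E →L[ℝ] ℝ := fun x => lam (-F x) • L - (k x * deriv lam (-F x)) • fderiv ℝ F x
    with hΦ
  have hev : fderiv ℝ (fun x => 1 + lam (-F x) * k x) =ᶠ[𝓝 x₀] Φ := by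
    filter_upwards [hL] with x hx
    rw [fderiv_boundaryAdapted hlam hF hk x, hx]
  rw [hev.fderiv_eq]
  -- differentiate `Φ`
  have hFd : HasFDerivAt F (fderiv ℝ F x₀) x₀ := (hF.differentiable (by simp) x₀).hasFDerivAt
  have hkd : HasFDerivAt k L x₀ := by
    have := (hk.differentiable (by simp) x₀).hasFDerivAt
    rwa [hL.self_of_nhds] at this
  have hF1 : ContDiff ℝ ∞ (fderiv ℝ F) := hF.fderiv_right le_rfl
  have hHd : HasFDerivAt (fderiv ℝ F) (fderiv ℝ (fderiv ℝ F) x₀) x₀ :=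
    (hF1.differentiable (by simp) x₀).hasFDerivAt
  have hlamd : HasDerivAt lam (deriv lam (-F x₀)) (-F x₀) :=
    (hlam.differentiable (by simp) _).hasDerivAt
  set mu : ℝ → ℝ := deriv lam with hmu
  have hlam1 : ContDiff ℝ ∞ mu := hlam.iterate_deriv 1
  have hlam'd : HasDerivAt mu (deriv mu (-F x₀)) (-F x₀) :=
    (hlam1.differentiable (by simp) _).hasDerivAt
  have hA0 : HasFDerivAt (fun x => lam (-F x)) (deriv lam (-F x₀) • (-fderiv ℝ F x₀)) x₀ :=
    hlamd.comp_hasFDerivAt x₀ hFd.neg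
  have hA : HasFDerivAt (fun x => lam (-F x) • L)
      ((deriv lam (-F x₀) • (-fderiv ℝ F x₀)).smulRight L) x₀ := hA0.smul_const L
  have hs0 : HasFDerivAt (fun x => mu (-F x)) (deriv mu (-F x₀) • (-fderiv ℝ F x₀)) x₀ :=
    HasDerivAt.comp_hasFDerivAt (h₂ := mu) x₀ hlam'd hFd.neg
  have hs : HasFDerivAt (fun x => k x * mu (-F x))
      (k x₀ • (deriv mu (-F x₀) • (-fderiv ℝ F x₀)) + mu (-F x₀) • L) x₀ :=
    hkd.mul hs0
  have hB : HasFDerivAt (fun x => (k x * mu (-F x)) • fderiv ℝ F x)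
      ((k x₀ * mu (-F x₀)) • fderiv ℝ (fderiv ℝ F) x₀ +
        (k x₀ • (deriv mu (-F x₀) • (-fderiv ℝ F x₀)) + mu (-F x₀) • L).smulRight
          (fderiv ℝ F x₀)) x₀ := hs.smul hHd
  have hΦd : HasFDerivAt Φ (((deriv lam (-F x₀) • (-fderiv ℝ F x₀)).smulRight L) -
      ((k x₀ * mu (-F x₀)) • fderiv ℝ (fderiv ℝ F) x₀ +
        (k x₀ • (deriv mu (-F x₀) • (-fderiv ℝ F x₀)) + mu (-F x₀) • L).smulRight
          (fderiv ℝ F x₀))) x₀ := hA.sub hB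
  rw [hΦd.fderiv]
  simp only [FunLike.coe_sub, FunLike.coe_add,
    FunLike.coe_smul, FunLike.coe_neg, Pi.sub_apply, Pi.add_apply,
    Pi.smul_apply, Pi.neg_apply, smul_eq_mul, ContinuousLinearMap.smulRight_apply]
  ring

end Calculus

/-! ### §3 Morse data on a regular sublevel set, local form -/

section LocalMorseData

variable {k : ℕ} {M : Type u} [TopologicalSpace M] [ChartedSpace (EuclideanSpace ℝ (Fin (k + 1))) M]
  [IsManifold (𝓡 (k + 1)) ∞ M]

/-- **Milnor 1963, Thm. 3.1 with the Morse data, local form** (the tree's `sublevel'_morseData`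
of `RegularLevelSplitting.lean` with its global hypothesis "`f` is a Morse function on `M`"
replaced by what the proof uses: `f` smooth, the level `a` non-critical, and the Hessian of `f`
nondegenerate at the critical points of `f` *in* `S = {f ≤ a}`; cf. `sublevel_morseData_local`
of `RegularSublevelMorseLocal.lean`, the same localisation for an ambient manifold with
boundary).  With the structure `sublevelAtlas'` on `S`: `S` is a `C^∞` manifold with boundary
`{f = a}`, smoothly embedded, and `f|_S + (1 - a)` is a Morse function adapted to `∂S` whose
critical points are those of `f` in `S`, with the same indices.  The proof is the tree's,
verbatim up to the sourcing of nondegeneracy. [cite: Milnor1963, Thm. 3.1] -/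
theorem sublevel'_morseData_of_nondegenerate {f : M → ℝ} (hfs : ContMDiff (𝓡 (k + 1)) 𝓘(ℝ, ℝ) ∞ f)
    {a : ℝ} (hreg : ∀ z, IsMCriticalPt (𝓡 (k + 1)) f z → f z ≠ a)
    (hnd : ∀ z, f z ≤ a → IsMCriticalPt (𝓡 (k + 1)) f z →
      (mhessian (𝓡 (k + 1)) f z).Nondegenerate) :
    ∃ (hreg' : ∀ p, f p = a → ¬ IsMCriticalPt (𝓡 (k + 1)) f p),
      letI := (sublevelAtlas' hfs a hreg').chartedSpace
      IsManifold (𝓡∂ (k + 1)) ∞ ↥(f ⁻¹' Iic a) ∧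
      Manifold.IsSmoothEmbedding (𝓡∂ (k + 1)) (𝓡 (k + 1)) ∞ (Subtype.val : ↥(f ⁻¹' Iic a) → M) ∧
      IsMorseAdapted (𝓡∂ (k + 1)) (fun x : ↥(f ⁻¹' Iic a) => f x + (1 - a)) ∧
      (∀ x : ↥(f ⁻¹' Iic a),
        IsMCriticalPt (𝓡∂ (k + 1)) (fun x : ↥(f ⁻¹' Iic a) => f x + (1 - a)) x ↔
          IsMCriticalPt (𝓡 (k + 1)) f x.1) ∧
      (∀ x : ↥(f ⁻¹' Iic a), IsMCriticalPt (𝓡 (k + 1)) f x.1 →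
        morseIndex (𝓡∂ (k + 1)) (fun x : ↥(f ⁻¹' Iic a) => f x + (1 - a)) x =
          morseIndex (𝓡 (k + 1)) f x.1) := by
  have hsmooth : ContMDiff (𝓡 (k + 1)) 𝓘(ℝ, ℝ) ∞ f := hfs
  have hreg' : ∀ p, f p = a → ¬ IsMCriticalPt (𝓡 (k + 1)) f p := fun p hp hc => hreg p hc hp
  refine ⟨hreg', ?_⟩
  set Φ := sublevelAtlas' hsmooth a hreg' with hΦ
  letI := Φ.chartedSpace
  haveI := Φ.isManifold
  set F : M → ℝ := fun y => f y + (1 - a) with hFdef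
  have hg : (fun x : ↥(f ⁻¹' Iic a) => f x + (1 - a)) = F ∘ Subtype.val := rfl
  have hFsmooth : ContMDiff (𝓡 (k + 1)) 𝓘(ℝ, ℝ) ∞ F :=
    ((contDiff_id.add contDiff_const : ContDiff ℝ ∞ fun t : ℝ => t + (1 - a))).comp_contMDiff hsmooth
  have hval : ContMDiff (𝓡∂ (k + 1)) (𝓡 (k + 1)) ∞ (Subtype.val : ↥(f ⁻¹' Iic a) → M) :=
    Φ.contMDiff_subtype_val'
  have hgsmooth : ContMDiff (𝓡∂ (k + 1)) 𝓘(ℝ, ℝ) ∞ (F ∘ Subtype.val) := hFsmooth.comp hval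
  have hFΘ : ∀ p : ↥(f ⁻¹' Iic a), ContDiffOn ℝ ∞ (F ∘ (Φ.datum p).Θ.symm) (Φ.datum p).Θ.target :=
    fun p => contMDiffOn_iff_contDiffOn.1 (hFsmooth.comp_contMDiffOn (Φ.datum p).contMDiffOn_symm)
  have hz₀ : ∀ p : ↥(f ⁻¹' Iic a), (Φ.datum p).Θ p.1 ∈ (Φ.datum p).Θ.target := fun p =>
    (Φ.datum p).Θ.map_source (Φ.mem_source p)
  have hFΘd : ∀ p : ↥(f ⁻¹' Iic a),
      DifferentiableAt ℝ (F ∘ (Φ.datum p).Θ.symm) ((Φ.datum p).Θ p.1) := fun p =>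
    ((hFΘ p _ (hz₀ p)).contDiffAt ((Φ.datum p).Θ.open_target.mem_nhds (hz₀ p))).differentiableAt
      (by simp)
  have hcritF : ∀ q, IsMCriticalPt (𝓡 (k + 1)) F q ↔ IsMCriticalPt (𝓡 (k + 1)) f q := by
    intro q
    have h1 := ((hsmooth.mdifferentiableAt (by simp)).hasMFDerivAt.add
      (hasMFDerivAt_const (I := 𝓡 (k + 1)) (I' := 𝓘(ℝ, ℝ)) (1 - a) q)).mfderiv
    have h2 : mfderiv (𝓡 (k + 1)) 𝓘(ℝ, ℝ) F q = mfderiv (𝓡 (k + 1)) 𝓘(ℝ, ℝ) f q :=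
      h1.trans (add_zero _)
    unfold IsMCriticalPt
    rw [h2]
    exact Iff.rfl
  have hcrit : ∀ p : ↥(f ⁻¹' Iic a),
      IsMCriticalPt (𝓡∂ (k + 1)) (F ∘ Subtype.val) p ↔ IsMCriticalPt (𝓡 (k + 1)) f p.1 := by
    intro p
    rw [← hcritF, IsMCriticalPt, Φ.mfderiv_comp_val_eq F p (hgsmooth.mdifferentiableAt (by simp))
      (hFΘd p), isMCriticalPt_iff_fderiv_comp_symm_eq_zero (Φ.datum p).contMDiffOn_toFun
      (Φ.datum p).contMDiffOn_symm (Φ.mem_source p) (hFsmooth.mdifferentiableAt (by simp))]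
    exact Iff.rfl
  have hhess : ∀ p : ↥(f ⁻¹' Iic a), IsMCriticalPt (𝓡 (k + 1)) f p.1 →
      mhessian (𝓡∂ (k + 1)) (F ∘ Subtype.val) p = mhessian (𝓡 (k + 1)) f p.1 := by
    intro p hp
    have hlt : f p.1 < a := lt_of_le_of_ne p.2 (hreg p.1 hp)
    have hD : Φ.datum p = sublevelChartLT' k f a hsmooth.continuous p.1 :=
      sublevelAtlas'_datum_of_lt hsmooth a hreg' p hlt
    set G : EuclideanSpace ℝ (Fin (k + 1)) → ℝ := writtenInExtChartAt (𝓡 (k + 1)) 𝓘(ℝ, ℝ) p.1 f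
      with hG
    set Fhat : EuclideanSpace ℝ (Fin (k + 1)) → ℝ := fun z => G (z + -shiftVec k p.1) with hFhat
    have hps : p.1 ∈ (Φ.datum p).Θ.source := Φ.mem_source p
    have h0 : 0 < (Φ.datum p).Θ p.1 0 := by
      rw [hD] at hps ⊢
      exact sublevelChartLT'_apply_zero_pos hps
    have hF' : (F ∘ (Φ.datum p).Θ.symm) =ᶠ[𝓝 ((Φ.datum p).Θ p.1)] fun z => Fhat z + (1 - a) := by
      refine Filter.Eventually.of_forall fun z => ?_
      rw [hD]
      simp [writtenInExtChartAt, hFdef, hFhat, hG]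
    rw [Φ.mhessian_comp_val_eq F p h0 hF']
    set z₀ : EuclideanSpace ℝ (Fin (k + 1)) := (Φ.datum p).Θ p.1 with hz₀def
    have hz₀v : z₀ + -shiftVec k p.1 = extChartAt (𝓡 (k + 1)) p.1 p.1 := by
      rw [hz₀def, hD, sublevelChartLT'_apply, add_neg_cancel_right]
    have hopen : IsOpen {z : EuclideanSpace ℝ (Fin (k + 1)) | 0 < z 0} :=
      isOpen_lt continuous_const (PiLp.continuous_apply 2 _ 0)
    have hHs : ∀ {z : EuclideanSpace ℝ (Fin (k + 1))}, 0 < z 0 → range (𝓡∂ (k + 1)) ∈ 𝓝 z :=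
      fun {z} hz => by
      rw [range_modelWithCornersEuclideanHalfSpace]
      exact mem_interior_iff_mem_nhds.1 (by rw [interior_halfSpace]; exact hz)
    have h1 : fderivWithin ℝ Fhat (range (𝓡∂ (k + 1))) =ᶠ[𝓝 z₀] fderiv ℝ Fhat := by
      filter_upwards [hopen.mem_nhds h0] with z hz
      exact fderivWithin_of_mem_nhds (hHs hz)
    have h2 : fderivWithin ℝ (fderivWithin ℝ Fhat (range (𝓡∂ (k + 1)))) (range (𝓡∂ (k + 1))) z₀ =
        fderiv ℝ (fderiv ℝ Fhat) z₀ := by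
      rw [h1.fderivWithin_eq_of_nhds, fderivWithin_of_mem_nhds (hHs h0)]
    have h3 : fderiv ℝ Fhat = fun z => fderiv ℝ G (z + -shiftVec k p.1) := by
      funext z
      exact fderiv_comp_add_right (-shiftVec k p.1)
    have h4 : fderiv ℝ (fderiv ℝ Fhat) z₀ = fderiv ℝ (fderiv ℝ G) (z₀ + -shiftVec k p.1) := by
      rw [h3]
      exact fderiv_comp_add_right (f := fderiv ℝ G) (-shiftVec k p.1)
    unfold mhessian
    rw [h2, h4, hz₀v, hG]
    simp only [ModelWithCorners.Boundaryless.range_eq_univ, fderivWithin_univ]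
  refine ⟨Φ.isManifold, Φ.isSmoothEmbedding_subtype_val', ⟨⟨?_, fun p hp => ?_⟩, fun p hp => ?_,
    fun p hp => ?_⟩, fun p => hcrit p, fun p hp => ?_⟩
  · rw [hg]; exact hgsmooth
  · rw [hg] at hp ⊢
    have hp' := (hcrit p).1 hp
    rw [hhess p hp']
    exact hnd p.1 p.2 hp'
  · have hpa : f p.1 = a := (isBoundaryPoint_sublevel'_iff hsmooth a hreg' p).1 hp
    refine ⟨by simp [hpa], fun hc => ?_⟩
    rw [hg, hcrit] at hc
    exact hreg p.1 hc hpa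
  · have hlt : f p.1 < a := (isInteriorPoint_sublevel'_iff hsmooth a hreg' p).1 hp
    show f p.1 + (1 - a) < 1
    linarith
  · rw [hg, morseIndex, morseIndex, hhess p hp]

/-- **Morse data on a regular sublevel set `Mᵃ`, local form** (Milnor 1963, Thm. 3.1 and §3):
if `a` is a regular level of the smooth `f` on a manifold without boundary and the Hessian of
`f` is nondegenerate at its critical points in `{f ≤ a}`, then `f|Mᵃ + (1 - a)` is a Morse
function adapted to `∂Mᵃ` on `Literature.Topology.FourManifolds.RegularSublevel`, its critical
points are those of `f` in `Mᵃ`, with the same indices (the tree's `RegularSublevel.morseData`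
without the hypothesis that `f` be Morse on all of `M`; declared by its absolute name as a
dot-notation extension of the tree's `RegularSublevel`). [cite: Milnor1963, Thm. 3.1 and §3] -/
theorem _root_.Literature.Topology.FourManifolds.RegularSublevel.morseData_of_nondegenerate
    {f : M → ℝ} {a : ℝ} (h : IsRegularLevel (𝓡 (k + 1)) f a)
    (hnd : ∀ z, f z ≤ a → IsMCriticalPt (𝓡 (k + 1)) f z →
      (mhessian (𝓡 (k + 1)) f z).Nondegenerate) :
    IsMorseAdapted (𝓡∂ (k + 1)) (fun x : RegularSublevel h => f (RegularSublevel.incl h x) + (1 - a)) ∧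
    (∀ x : RegularSublevel h,
      IsMCriticalPt (𝓡∂ (k + 1))
        (fun x : RegularSublevel h => f (RegularSublevel.incl h x) + (1 - a)) x ↔
        IsMCriticalPt (𝓡 (k + 1)) f (RegularSublevel.incl h x)) ∧
    (∀ x : RegularSublevel h, IsMCriticalPt (𝓡 (k + 1)) f (RegularSublevel.incl h x) →
      morseIndex (𝓡∂ (k + 1))
        (fun x : RegularSublevel h => f (RegularSublevel.incl h x) + (1 - a)) x =
        morseIndex (𝓡 (k + 1)) f (RegularSublevel.incl h x)) := by
  obtain ⟨_, -, -, h1, h2, h3⟩ := sublevel'_morseData_of_nondegenerate h.contMDiff (a := a)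
    (fun z hz hza => h.not_isMCriticalPt hza hz) hnd
  exact ⟨h1, h2, h3⟩

end LocalMorseData

/-! ### §4 The handlebody theorem -/

section Assembly

variable {n : ℕ}

/-- **`{G ≤ 1} = {F ≤ 0}`** for `G = 1 + λ(-F) k` with `k < 0`, `λ(0) = 0`, `λ < 0` on
`(-∞, 0)`, `λ > 0` on `(0, ∞)`. [folklore] -/
theorem boundaryAdapted_le_one_iff {lam : ℝ → ℝ} (hlam0 : lam 0 = 0)
    (hlamneg : ∀ s, s < 0 → lam s < 0) (hlampos : ∀ s, 0 < s → 0 < lam s)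
    {E : Type*} {F k : E → ℝ} (hkneg : ∀ x, k x < 0) (x : E) :
    1 + lam (-F x) * k x ≤ 1 ↔ F x ≤ 0 := by
  constructor
  · intro h
    by_contra hF
    push Not at hF
    have h1 : lam (-F x) < 0 := hlamneg _ (by linarith)
    have h2 : 0 < lam (-F x) * k x := mul_pos_of_neg_of_neg h1 (hkneg x)
    linarith
  · intro hF
    rcases hF.lt_or_eq with hlt | heq
    · have h1 : 0 < lam (-F x) := hlampos _ (by linarith)
      have h2 : lam (-F x) * k x < 0 := mul_neg_of_pos_of_neg h1 (hkneg x)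
      linarith
    · rw [heq, neg_zero, hlam0, zero_mul, add_zero]

/-- **`{G = 1} = {F = 0}`** for `G = 1 + λ(-F) k` as in `boundaryAdapted_le_one_iff`. [folklore] -/
theorem boundaryAdapted_eq_one_iff {lam : ℝ → ℝ} (hlam0 : lam 0 = 0)
    (hlamneg : ∀ s, s < 0 → lam s < 0) (hlampos : ∀ s, 0 < s → 0 < lam s)
    {E : Type*} {F k : E → ℝ} (hkneg : ∀ x, k x < 0) (x : E) :
    1 + lam (-F x) * k x = 1 ↔ F x = 0 := by
  constructor
  · intro h
    by_contra hF
    rcases lt_or_gt_of_ne hF with hlt | hgt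
    · have h1 : 0 < lam (-F x) := hlampos _ (by linarith)
      have h2 : lam (-F x) * k x < 0 := mul_neg_of_pos_of_neg h1 (hkneg x)
      linarith
    · have h1 : lam (-F x) < 0 := hlamneg _ (by linarith)
      have h2 : 0 < lam (-F x) * k x := mul_pos_of_neg_of_neg h1 (hkneg x)
      linarith
  · intro hF
    rw [hF, neg_zero, hlam0, zero_mul, add_zero]

/-- **A compact domain with `p`-convex boundary is a `(p-1)`-handlebody** (the Morse-theoretic
mechanism of Sha 1986, Thm. 1 / Wu 1987 / Xiong 2018, §4, in the flat case, realised by the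
boundary-adapted generic height function; this is also the reading asked for by the route
`ConvexityLadder`, item `CvxThreeConvexBoundsTwoHandlebody`: "a `k`-convex `Σ` bounds a
`(k-1)`-handlebody").  Let `F` be smooth on `ℝⁿ⁺¹` with `Ω = {F ≤ 0}` compact, `DF ≠ 0` on
`{F = 0}`, and `∑ᵢ D²F(x)(vᵢ, vᵢ) > 0` for every `x ∈ {F = 0}` and every orthonormal
`p`-frame `(vᵢ)` in `ker DF(x)` (`p ≥ 1`).  Then there is a smooth `G` with regular level `1`
(`Literature.Topology.FourManifolds.IsRegularLevel`) and `{G ≤ 1} = Ω`, such that the compact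
manifold with boundary `Literature.Topology.FourManifolds.RegularSublevel` (`= Ω` with boundary
`∂Ω = {F = 0}`, homeomorphic to `{x // F x ≤ 0}`) is a handlebody with handles of index
`≤ p - 1` (`Literature.Topology.FourManifolds.IsHandlebodyOfIndexLE n (p - 1)`: `G|Ω` is a
Morse function adapted to `∂Ω` all of whose critical points have index `≤ p - 1`).
Construction: `G = 1 + λ(-F) · k` with the profile `λ = λ_σ` of `exists_boundaryProfile`, the
cut-off height `k` of `exists_neg_cutoff` for a generic direction `a`
(`exists_direction_forall_horizontal_separating`), and `σ` smaller than the collar depths of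
`exists_collar_le_norm_fderiv`, `exists_collar_sum_pos`, `exists_uniform_tangential_margin` and
than `m² / C` for the constants `m ≤ ‖DF‖`, `|D²F| ≤ M`, margin `η`, nondegeneracy margin `m₀`.
A critical point `x` of `G` in `Ω` has depth `0 < s = -F(x) < σ` with `λ'(s) > 0` and `∇F(x)`
antiparallel to `a`; its Hessian (`MorseBirth.mhessian_model_apply`,
`fderiv_fderiv_boundaryAdapted`) is `κ D²F(x) + N DF(x) ⊗ DF(x)` with `κ = -k λ' > 0` and
`N ‖DF‖² ≥ κ ‖DF‖²/s ≥ κ m²/σ ≥ κ C` (profile inequality), so it is nondegenerate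
(`nondegenerate_of_tangential_margin`) of index `< p` (`sigNeg_lt_of_tangential_sum_pos`); the
Morse data descend to `Ω` by `RegularSublevel.morseData_of_nondegenerate`.
[cite: Sha1986, Thm. 1] [cite: Xiong2018, Thm. 4 (i) and §4] -/
theorem exists_isRegularLevel_isHandlebodyOfIndexLE {p : ℕ} (hp : 1 ≤ p)
    {F : EuclideanSpace ℝ (Fin (n + 1)) → ℝ} (hF : ContDiff ℝ ∞ F)
    (hK : IsCompact {x | F x ≤ 0}) (hreg : ∀ x, F x = 0 → fderiv ℝ F x ≠ 0)
    (hconv : ∀ x, F x = 0 → ∀ v : Fin p → EuclideanSpace ℝ (Fin (n + 1)), Orthonormal ℝ v →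
      (∀ i, fderiv ℝ F x (v i) = 0) → 0 < ∑ i, iteratedFDeriv ℝ 2 F x ![v i, v i]) :
    ∃ (G : EuclideanSpace ℝ (Fin (n + 1)) → ℝ) (hG : IsRegularLevel (𝓡 (n + 1)) G 1),
      (∀ x, G x ≤ 1 ↔ F x ≤ 0) ∧ CompactSpace (RegularSublevel hG) ∧
      IsHandlebodyOfIndexLE n (p - 1) (RegularSublevel hG) ∧
      Nonempty (RegularSublevel hG ≃ₜ {x // F x ≤ 0}) := by
  -- `p`-convexity with `fderiv ∘ fderiv`
  have hconv' : ∀ x, F x = 0 → ∀ v : Fin p → EuclideanSpace ℝ (Fin (n + 1)), Orthonormal ℝ v →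
      (∀ i, fderiv ℝ F x (v i) = 0) → 0 < ∑ i, fderiv ℝ (fderiv ℝ F) x (v i) (v i) := by
    intro x hx v hv htan
    have := hconv x hx v hv htan
    simpa only [iteratedFDeriv_two_apply, Matrix.cons_val_zero, Matrix.cons_val_one,
      Matrix.head_cons] using this
  have hp0 : (0 : ℝ) < p := by exact_mod_cast hp
  -- constants of `F` on a collar of the boundary
  obtain ⟨δ₁, hδ₁, m, hm, hgrad⟩ := exists_collar_le_norm_fderiv hF hK hreg
  obtain ⟨M, hM0, hMb⟩ := exists_bound_fderiv_fderiv hF hK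
  obtain ⟨δ₂, hδ₂, η, hη, hpos⟩ := exists_collar_sum_pos hF hK hconv'
  have hK0 : IsCompact {x : EuclideanSpace ℝ (Fin (n + 1)) | F x = 0} :=
    hK.of_isClosed_subset (isClosed_eq hF.continuous continuous_const) fun x hx => le_of_eq hx
  obtain ⟨a, ha0, hsep⟩ := exists_direction_forall_horizontal_separating hF hK0 hreg
  obtain ⟨m₀, hm₀, δ₃, hδ₃, hmargin⟩ := exists_uniform_tangential_margin hF hK hreg hsep
  obtain ⟨k, c₁, N, hk, hkneg, hNopen, hKN, hkN⟩ := exists_neg_cutoff hK a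
  -- the depth `σ` of the collar carrying the critical points
  set Cst : ℝ := M + 2 * p * M ^ 2 / η + M * (1 + M / m₀) + 1 with hCst
  have hCst0 : 0 < Cst := by positivity
  set σ : ℝ := min (min δ₁ (min δ₂ δ₃)) (m ^ 2 / Cst) with hσ
  have hσ0 : 0 < σ := by positivity
  have hσ₁ : σ ≤ δ₁ := (min_le_left _ _).trans (min_le_left _ _)
  have hσ₂ : σ ≤ δ₂ := (min_le_left _ _).trans ((min_le_right _ _).trans (min_le_left _ _))
  have hσ₃ : σ ≤ δ₃ := (min_le_left _ _).trans ((min_le_right _ _).trans (min_le_right _ _))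
  have hσC : σ ≤ m ^ 2 / Cst := min_le_right _ _
  obtain ⟨lam, hlam, hlam0, hlam'0, hlamneg, hlampos, hlam'nn, hlam'σ, hineq⟩ :=
    exists_boundaryProfile hσ0
  -- the boundary-adapted height function
  set G : EuclideanSpace ℝ (Fin (n + 1)) → ℝ := fun x => 1 + lam (-F x) * k x with hGdef
  have hGs : ContDiff ℝ ∞ G :=
    contDiff_const.add ((hlam.comp hF.neg).mul hk)
  have hGle : ∀ x, G x ≤ 1 ↔ F x ≤ 0 := fun x =>
    boundaryAdapted_le_one_iff hlam0 hlamneg hlampos hkneg x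
  have hGeq : ∀ x, G x = 1 ↔ F x = 0 := fun x =>
    boundaryAdapted_eq_one_iff hlam0 hlamneg hlampos hkneg x
  -- `Dk = ⟪a, ·⟫` near `Ω`
  set L : EuclideanSpace ℝ (Fin (n + 1)) →L[ℝ] ℝ := innerSL ℝ a with hL
  have hDk : ∀ x ∈ N, ∀ᶠ y in 𝓝 x, fderiv ℝ k y = L := by
    intro x hx
    filter_upwards [hNopen.mem_nhds hx] with y hy
    have hev : k =ᶠ[𝓝 y] fun z => ⟪a, z⟫_ℝ - c₁ := by
      filter_upwards [hNopen.mem_nhds hy] with z hz using hkN z hz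
    rw [hev.fderiv_eq, fderiv_sub_const]
    exact (innerSL ℝ a).fderiv
  have hDG : ∀ x ∈ N, fderiv ℝ G x = lam (-F x) • L - (k x * deriv lam (-F x)) • fderiv ℝ F x := by
    intro x hx
    rw [hGdef, fderiv_boundaryAdapted hlam hF hk x, (hDk x hx).self_of_nhds]
  -- the top level `{G = 1} = {F = 0}` is regular
  have hregG : ∀ x, G x = 1 → fderiv ℝ G x ≠ 0 := by
    intro x hx h0
    have hFx : F x = 0 := (hGeq x).1 hx
    have hxN : x ∈ N := hKN (le_of_eq hFx)
    rw [hDG x hxN, hFx, neg_zero, hlam0, hlam'0, zero_smul, mul_one, zero_sub, neg_eq_zero,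
      smul_eq_zero] at h0
    rcases h0 with h0 | h0
    · exact (hkneg x).ne h0
    · exact hreg x hFx h0
  have hGlev : IsRegularLevel (𝓡 (n + 1)) G 1 :=
    { contMDiff := hGs.contMDiff
      isInteriorPoint := fun x _ => BoundarylessManifold.isInteriorPoint
      not_isMCriticalPt := fun x hx hc => hregG x hx
        ((MorseBirth.isMCriticalPt_iff_fderiv G x).1 hc) }
  -- analysis of a critical point `x ∈ Ω`
  have hcritical : ∀ x, F x ≤ 0 → fderiv ℝ G x = 0 →
      morseIndex (𝓡 (n + 1)) G x < p ∧ (mhessian (𝓡 (n + 1)) G x).Nondegenerate := by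
    intro x hFx h0
    have hxN : x ∈ N := hKN hFx
    have hFx0 : F x ≠ 0 := fun h => hregG x ((hGeq x).2 h) h0
    have hFlt : F x < 0 := lt_of_le_of_ne hFx hFx0
    set s : ℝ := -F x with hs
    have hs0 : 0 < s := by rw [hs]; linarith
    set l := lam s with hl
    set l' := deriv lam s with hl'
    set l'' := deriv (deriv lam) s with hl''
    have hl0 : 0 < l := hlampos s hs0
    have hkx : k x < 0 := hkneg x
    set wt : ℝ := -k x with hwt
    have hwt0 : 0 < wt := by rw [hwt]; linarith
    -- criticality: `λ L = (k λ') DF`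
    have hcrit : l • L = (k x * l') • fderiv ℝ F x := by
      have := h0
      rw [hDG x hxN] at this
      exact sub_eq_zero.1 this
    have hl'ne : l' ≠ 0 := by
      intro h
      rw [h, mul_zero, zero_smul, smul_eq_zero] at hcrit
      rcases hcrit with h1 | h1
      · exact hl0.ne' h1
      · have h2 : innerSL ℝ a = 0 := by rw [← hL]; exact h1
        have h3 : ⟪a, a⟫_ℝ = 0 := by
          simpa using congrArg (fun f : EuclideanSpace ℝ (Fin (n + 1)) →L[ℝ] ℝ => f a) h2
        exact ha0 (inner_self_eq_zero.1 h3)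
    have hl'0 : 0 < l' := lt_of_le_of_ne (hlam'nn s hs0) (Ne.symm hl'ne)
    have hsσ : s < σ := by
      by_contra h
      push Not at h
      exact hl'ne (hlam'σ s h)
    have hF1 : -δ₁ ≤ F x := by rw [hs] at hsσ; linarith
    have hF2 : -δ₂ ≤ F x := by rw [hs] at hsσ; linarith
    have hF3 : -δ₃ ≤ F x := by rw [hs] at hsσ; linarith
    -- the gradient
    have hmg : m ≤ ‖fderiv ℝ F x‖ := hgrad x hF1 hFx
    set g : EuclideanSpace ℝ (Fin (n + 1)) := (InnerProductSpace.toDual ℝ _).symm (fderiv ℝ F x)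
      with hg
    have hg_inner : ∀ u, ⟪g, u⟫_ℝ = fderiv ℝ F x u := fun u => by
      simp [hg, InnerProductSpace.toDual_symm_apply]
    have hgnorm : ‖g‖ = ‖fderiv ℝ F x‖ := by simp [hg]
    have hg0 : g ≠ 0 := by
      rw [← norm_pos_iff, hgnorm]; linarith
    -- horizontality: `DF = c ⟪a, ·⟫`
    set c : ℝ := l / (k x * l') with hc
    have hkl' : k x * l' ≠ 0 := mul_ne_zero hkx.ne hl'ne
    have hDF : fderiv ℝ F x = c • innerSL ℝ a := by
      rw [hc, div_eq_mul_inv, mul_comm, ← smul_smul, ← hL, hcrit, smul_smul,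
        inv_mul_cancel₀ hkl', one_smul]
    have hLc : L = ((k x * l') / l) • fderiv ℝ F x := by
      have hkx0 : k x ≠ 0 := hkx.ne
      have h1 : (k x * l') / l * c = 1 := by
        rw [hc]; field_simp
      rw [hDF, smul_smul, h1, one_smul, hL]
    -- the Hessian of `G` at `x`
    set B : LinearMap.BilinForm ℝ (EuclideanSpace ℝ (Fin (n + 1))) := mhessian (𝓡 (n + 1)) G x
      with hB
    set D : LinearMap.BilinForm ℝ (EuclideanSpace ℝ (Fin (n + 1))) :=
      (ContinuousLinearMap.coeLM ℝ).comp (fderiv ℝ (fderiv ℝ F) x).toLinearMap with hD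
    have hDapp : ∀ u w, D u w = fderiv ℝ (fderiv ℝ F) x u w := fun u w => rfl
    set κ : ℝ := wt * l' with hκ
    set Nc : ℝ := wt * (2 * l' ^ 2 / l - l'') with hNc
    have hκ0 : 0 < κ := mul_pos hwt0 hl'0
    have hBapp : ∀ u w, B u w = κ * D u w + Nc * ⟪g, u⟫_ℝ * ⟪g, w⟫_ℝ := by
      intro u w
      rw [hB, MorseBirth.mhessian_model_apply, hGdef,
        fderiv_fderiv_boundaryAdapted hlam hF hk (hDk x hxN) u w, hDapp, hg_inner, hg_inner]
      have hLu : ∀ v, L v = (k x * l') / l * fderiv ℝ F x v := fun v => by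
        rw [hLc]; rfl
      rw [hLu, hLu, hκ, hNc, hwt, ← hs]
      field_simp
      ring
    -- symmetry and bounds for `D`
    have hFC2 : ContDiff ℝ 2 F := hF.of_le (by norm_cast)
    have hDs : ∀ u w, D u w = D w u := fun u w => by
      rw [hDapp, hDapp]
      exact (hFC2.contDiffAt (x := x)).isSymmSndFDerivAt (by simp) u w
    have hDM : ∀ u w, |D u w| ≤ M * ‖u‖ * ‖w‖ := fun u w => by rw [hDapp]; exact hMb x hFx u w
    have hDpos : ∀ v : Fin p → EuclideanSpace ℝ (Fin (n + 1)), Orthonormal ℝ v →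
        (∀ i, ⟪g, v i⟫_ℝ = 0) → η ≤ ∑ i, D (v i) (v i) := by
      intro v hv htan
      simp only [hDapp]
      exact hpos x hF2 hFx v hv fun i => by rw [← hg_inner]; exact htan i
    -- `N/κ ≥ 1/s`, from the profile inequality
    have hNcκ : κ / s ≤ Nc := by
      have h1 := hineq s hs0
      rw [hκ, hNc, div_le_iff₀ hs0]
      rw [← hl, ← hl', ← hl''] at h1
      have h2 : wt * l' * l ≤ wt * (2 * l' ^ 2 / l - l'') * s * l := by
        have h3 : wt * (2 * l' ^ 2 / l - l'') * s * l = wt * (s * (2 * l' ^ 2 - l * l'')) := by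
          field_simp
        rw [h3, mul_assoc]
        exact mul_le_mul_of_nonneg_left (by linarith) hwt0.le
      exact le_of_mul_le_mul_right h2 hl0
    have hNcg : κ * (m ^ 2 / σ) ≤ Nc * ‖g‖ ^ 2 := by
      have h1 : κ * (m ^ 2 / σ) ≤ κ * (m ^ 2 / s) := by
        apply mul_le_mul_of_nonneg_left _ hκ0.le
        exact div_le_div_of_nonneg_left (sq_nonneg m) hs0 hsσ.le
      have h2 : κ * (m ^ 2 / s) = κ / s * m ^ 2 := by ring
      have h3 : κ / s * m ^ 2 ≤ Nc * m ^ 2 := mul_le_mul_of_nonneg_right hNcκ (sq_nonneg m)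
      have hNc0 : 0 ≤ Nc := le_trans (div_nonneg hκ0.le hs0.le) hNcκ
      have h4 : Nc * m ^ 2 ≤ Nc * ‖g‖ ^ 2 := by
        apply mul_le_mul_of_nonneg_left _ hNc0
        rw [hgnorm]
        exact pow_le_pow_left₀ hm.le hmg 2
      linarith
    have hCσ : Cst ≤ m ^ 2 / σ := by
      rw [le_div_iff₀ hσ0]
      calc Cst * σ ≤ Cst * (m ^ 2 / Cst) := mul_le_mul_of_nonneg_left hσC hCst0.le
        _ = m ^ 2 := by field_simp
    -- index bound
    have hidx : sigNeg B.toQuadraticMap < p := by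
      refine sigNeg_lt_of_tangential_sum_pos D B hDs hg0 hp hη hκ0 hDM hDpos ?_ hBapp
      have h1 : M + 2 * p * M ^ 2 / η ≤ Cst := by
        rw [hCst]
        have : 0 ≤ M * (1 + M / m₀) := by positivity
        linarith
      calc κ * (M + 2 * p * M ^ 2 / η) ≤ κ * (m ^ 2 / σ) :=
            mul_le_mul_of_nonneg_left (h1.trans hCσ) hκ0.le
        _ ≤ Nc * ‖g‖ ^ 2 := hNcg
    -- nondegeneracy
    have hnd : B.Nondegenerate := by
      refine nondegenerate_of_tangential_margin D B hg0 hm₀ hκ0 hDM ?_ ?_ hBapp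
      · intro t ht
        obtain ⟨u, hu, hu1, hle⟩ := hmargin x hF3 hFx ⟨c, hDF⟩ t (by rw [← hg_inner]; exact ht)
        exact ⟨u, by rw [hg_inner]; exact hu, hu1, by rw [hDapp]; exact hle⟩
      · have h1 : M * (1 + M / m₀) < Cst := by
          rw [hCst]
          have : 0 ≤ 2 * p * M ^ 2 / η := by positivity
          linarith
        calc κ * M * (1 + M / m₀) = κ * (M * (1 + M / m₀)) := by ring
          _ < κ * (m ^ 2 / σ) := mul_lt_mul_of_pos_left (h1.trans_le hCσ) hκ0
          _ ≤ Nc * ‖g‖ ^ 2 := hNcg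
    exact ⟨hidx, hnd⟩
  -- Morse data on the compact manifold with boundary `{G ≤ 1} = Ω`
  have hndG : ∀ z, G z ≤ 1 → IsMCriticalPt (𝓡 (n + 1)) G z →
      (mhessian (𝓡 (n + 1)) G z).Nondegenerate := fun z hz hc =>
    (hcritical z ((hGle z).1 hz) ((MorseBirth.isMCriticalPt_iff_fderiv G z).1 hc)).2
  obtain ⟨hadapt, hcrit, hidx⟩ := RegularSublevel.morseData_of_nondegenerate hGlev hndG
  have hset : G ⁻¹' Iic 1 = {x | F x ≤ 0} := Set.ext fun x => hGle x
  have hcpt : CompactSpace (RegularSublevel hGlev) :=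
    isCompact_iff_compactSpace.1 (hset ▸ hK : IsCompact (G ⁻¹' Iic 1))
  refine ⟨G, hGlev, hGle, hcpt, ⟨_, hadapt, fun z hz => ?_⟩, ⟨Homeomorph.setCongr hset⟩⟩
  have hz' : IsMCriticalPt (𝓡 (n + 1)) G (RegularSublevel.incl hGlev z) := (hcrit z).1 hz
  rw [hidx z hz']
  have h1 := (hcritical (RegularSublevel.incl hGlev z) ((hGle _).1 z.2)
    ((MorseBirth.isMCriticalPt_iff_fderiv G _).1 hz')).1
  rw [morseIndex] at h1 ⊢
  omega

end Assembly

end Literature.Geometry.Riemannian
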